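import Literature.AlgebraicGeometry.AbelianSchemes.PoincareSheafBiadditiveNoetherian
import Literature.AlgebraicGeometry.AbelianSchemes.AbelianSchemeKOfLLocal
import Literature.AlgebraicGeometry.AbelianSchemes.AbelianSchemeKOfLFibres
import Literature.AlgebraicGeometry.Modules.LineBundleOfCocycleClass
import HarnessLib

/-!
# The theorem of the square for an abelian scheme over a CONNECTED locally Noetherian base (possibly NON-reduced),
# given a dual pair: `Λ(L)|_{u·v} ≅ Λ(L)|_u ⊗ Λ(L)|_v`, and `Λ(L) : A → Â` as a homomorphism with kernel `K(L)`

Layer `Literature/AlgebraicGeometry/AbelianSchemes`, namespace `Literature.AlgebraicGeometry.AbelianSchemes.AbelianSchemeOver`.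
THEOREMS ONLY (no definition, no named fact, no instance, no notation).  Cell `hodgecm-mathlib` (D-0151), price-sheet row
F-2d «theorem of the square / cube over a possibly NON-REDUCED base», road (R-dual) FILE 2 (road of record, B-plan1 (g15)
2026-08-30T02:44:29Z; author B-p07 (g15); census `B-provers/B-p07/g15/CENSUS-F2d-CubeOverBase.B-p07g15.md`).

SETTING.  `A/S` an abelian scheme, `L` a rank-one module on `A` rigidified along the zero section (`ε^*[L] = 1`),
`Λ(L) = m^*L ⊗ p₁^*L⁻¹ ⊗ p₂^*L⁻¹` its MUMFORD BUNDLE on `A ×_S A` (★ `mumfordBundle`, [MumfordFogartyKirwan1994] Ch. 6 §2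
Def. 6.2 p. 120), and for an `S`-morphism `u : T → A` the restriction `Λ(L)|_u = (1_A × u)^*Λ(L)` on `A ×_S T` — the
family `T ↦ [t_u^*L_T ⊗ L_T⁻¹]` whose vanishing locus is `K(L)` (★ `MemKOfL`, [MumfordAV1970] §13).  `D = (Â, 𝒫)` a DUAL
PAIR of `A` ([MilneAV2008] I §8 as an interface, ★ `DualPair`) satisfying the unit hypothesis `hD : 𝒫|_{A × {ε_Â}} ≅ 𝒪`
(★ `AbelianSchemeDualTransport`; discharged from any polarisation by ★ `AbelianSchemeDualTransportUnit`).

* §1 `baseChangeToProd_self_id` / `fibreBaseChangeIso_comp_baseChangeToProd` — plumbing: `1_A × 1_A = 𝟙` and «the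
  geometric fibre at `t` of the family `(1_A × g)^*Λ(L)` on `A_T` is the family `(1_A × g(t))^*Λ(L)` on `A_{κ̄(t)}`».
* §2 `cechPic_pullback_translation_phi`, **`isHomogeneous_pullback_baseChangeToProd_mumfordBundle`** — FIELD LEVEL: for a
  field-valued point `s` of `S` and a point `g₀ : Spec Ω → A` over `s`, the module `(1_A × g₀)^*Λ(L)` on the abelian VARIETY
  `A_s` is translation invariant (lies in `Pic⁰`): its class is `φ_{[L_s]}(P) = t_P^*[L_s]·[L_s]⁻¹`
  (★ `pullback_whiskerLeft_mumfordClass_homMk`, B-p05) and `t_Q^*φ(P) = φ(P)` IS the theorem of the square on `A_s`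
  (★ `pullback_translation_mul_mul_self'`, [MumfordAV1970] §6 Cor. 4).
* §3 `hasRank_mumfordFamily`, `rigid_mumfordFamily`, **`fibrewisePicZero_mumfordFamily`** — for every `f : T → S` and
  `g : T → A` over `f`, the family `(1_A × g)^*Λ(L)` on `A_T` is a RIGIDIFIED (★
  `nonempty_pullback_unitSection_baseChangeToProd_mumfordBundle_iso`, B-p08) FIBREWISE-`Pic⁰` (§2) line bundle — a test object
  of the universal property of `D`.
* §4 `nonempty_pullback_baseChangeToProd_universalMumford_iso`, **`exists_isMonHom_classify_mumfordBundle`** —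
  [MumfordFogartyKirwan1994] Def. 6.2 «`Λ(L) : A → Â`» over a connected locally Noetherian base: there is an `S`-HOMOMORPHISM
  `λ_L : A → Â` with (ii) `(1_A × (u ≫ λ_L))^*𝒫 ≅ Λ(L)|_u` for every `S`-morphism `u : T → A` — the classifying morphism of
  `Λ(L)` (★ `DualPair.universal`, naturality through ★ `DualPair.baseChangeToProd_comp`) — and (iii) `u ∈ K(L)(T) ↔ u ≫ λ_L = 1`
  (`K(L) = ker λ_L` on `T`-valued points, ★ `MemKOfL`, [MumfordAV1970] §13; uniqueness in the universal property against the
  value at `ε`); (i) `λ_L` kills the unit because `Λ(L)|_ε ≅ 𝒪` (★ `kOfL`, `one_mem`) and `hD`, HENCE is a homomorphism by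
  rigidity ([MumfordFogartyKirwan1994] Cor. 6.4, ★ `isMonHom_of_one_comp_of_isLocallyNoetherian` — no reducedness).
* §5 **`nonempty_pullback_whiskerLeft_mul_mumfordBundle_iso` — THE THEOREM OF THE SQUARE over ANY `S`-scheme `T`**:
  `Λ(L)|_{u·v} ≅ Λ(L)|_u ⊗ Λ(L)|_v` for `u, v : T → A` ([MumfordAV1970] §6 Cor. 4 / [MumfordFogartyKirwan1994] p. 120 «`Λ(L)`
  is a homomorphism» over a base): `λ_L` is a homomorphism and the group law of `Â` is the tensor product of families over
  a connected locally Noetherian base (★ `nonempty_pullbackP_mul_iso_of_isLocallyNoetherian`, FILE 1).  Class form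
  `cechPic_pullback_whiskerLeft_mul_mumfordClass` (every class is the class of a line bundle, ★ `lineBundle`).

ROAD NOTE.  Everything is CONDITIONAL on the dual pair `D` (data of every polarised family in the tree's moduli functor,
★ D1–D4) — the unconditional theorem of the cube over a non-reduced base (Artinian induction, GW II Lemma 24.72) and the
relative seesaw subscheme are the parked roads (R-def)/(R-ss) of the census.  HC_CM is proved only modulo the 7 printed
citations until rung 0 closes; nothing here is about HC.

## References
* [MumfordAV1970] D. Mumford, *Abelian Varieties* (1970), §6 Cor. 4 (p. 59), §8 (pp. 74–75), §13 (pp. 123–125).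
* [MumfordFogartyKirwan1994] D. Mumford, J. Fogarty, F. Kirwan, *Geometric Invariant Theory*, 3rd ed. (1994), Ch. 6 §1
  Cor. 6.4 (p. 117), §2 Definition 6.2 (p. 120), App. 7B (p. 240).
* [MilneAV2008] J. S. Milne, *Abelian Varieties* (v2.00, 2008), I §8 pp. 36–37.
-/

set_option backward.isDefEq.respectTransparency false

noncomputable section

open CategoryTheory CategoryTheory.Limits AlgebraicGeometry MonoidalCategory CartesianMonoidalCategory
open scoped MonObj

universe u

namespace Literature.AlgebraicGeometry.AbelianSchemes

open Literature.AlgebraicGeometry.Motives Literature.AlgebraicGeometry.Modules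
  Literature.AlgebraicGeometry.AbelianVarieties

namespace AbelianSchemeOver

variable {S : Scheme.{u}} (A : AbelianSchemeOver S) {L : A.left.Modules}

/-! ## §1 Plumbing: `1_A × 1_A = 𝟙`; the geometric fibre of the family `(1_A × g)^*Λ(L)` -/

/-- `1_A × 1_A = 𝟙_{A ×_S A}`. [cite: MilneAV2008, I §8 pp. 36–37] -/
theorem baseChangeToProd_self_id : A.baseChangeToProd A A.X.hom (𝟙 _) (Category.id_comp _) = 𝟙 _ := by
  apply pullback.hom_ext
  · exact (A.baseChangeToProd_fst A _ _ _).trans (Category.id_comp _).symm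
  · exact (A.baseChangeToProd_snd A _ _ _).trans ((Category.comp_id _).trans (Category.id_comp _).symm)

/-- **The geometric fibre at `t` of `1_A × g` is `1_A × (t ≫ g)`**: along `(A_T)_t ≅ A_{t ≫ f}` (★ `fibreBaseChangeIso`),
`1_A × (t ≫ g) : A_{t ≫ f} → A ×_S A` is the fibre inclusion `(A_T)_t → A_T` followed by `1_A × g` (both components agree:
★ `fibreBaseChangeIso_hom_toSchemeHom_fst/snd`). [cite: GortzWedhorn2020, Section (4.7) (pp. 107–108)] -/
theorem fibreBaseChangeIso_comp_baseChangeToProd {T : Scheme.{u}} (f : T ⟶ S) (g : T ⟶ A.X.left) (hg : g ≫ A.X.hom = f)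
    {Ω : Type u} [Field Ω] (t : Spec (.of Ω) ⟶ T) :
    AbelianVariety.Hom.toSchemeHom (A.fibreBaseChangeIso f t).hom ≫
        A.baseChangeToProd A (t ≫ f) (t ≫ g) (by rw [Category.assoc, hg]) =
      pullback.fst (A.baseChange f).X.hom t ≫ A.baseChangeToProd A f g hg := by
  apply pullback.hom_ext
  · -- first components: both are `(A_T)_t → A_T → A`
    exact (Category.assoc _ _ _).trans
      (((congrArg (fun x => AbelianVariety.Hom.toSchemeHom (A.fibreBaseChangeIso f t).hom ≫ x)
          (A.baseChangeToProd_fst A (t ≫ f) (t ≫ g) _)).trans (A.fibreBaseChangeIso_hom_toSchemeHom_fst f t)).trans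
        ((Category.assoc _ _ _).trans
          (congrArg (fun x => pullback.fst (A.baseChange f).X.hom t ≫ x) (A.baseChangeToProd_fst A f g hg))).symm)
  · -- second components: both are `(A_T)_t → Spec Ω → T → A`
    have hc : pullback.fst (A.baseChange f).X.hom t ≫ pullback.snd A.X.hom f = pullback.snd (A.baseChange f).X.hom t ≫ t :=
      pullback.condition
    have lhs : (AbelianVariety.Hom.toSchemeHom (A.fibreBaseChangeIso f t).hom ≫
        A.baseChangeToProd A (t ≫ f) (t ≫ g) (by rw [Category.assoc, hg])) ≫ pullback.snd A.X.hom A.X.hom =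
        pullback.snd (A.baseChange f).X.hom t ≫ t ≫ g :=
      (Category.assoc _ _ _).trans
        ((congrArg (fun x => AbelianVariety.Hom.toSchemeHom (A.fibreBaseChangeIso f t).hom ≫ x)
            (A.baseChangeToProd_snd A (t ≫ f) (t ≫ g) _)).trans
          ((Category.assoc _ _ _).symm.trans
            (congrArg (fun x => x ≫ t ≫ g) (A.fibreBaseChangeIso_hom_toSchemeHom_snd f t))))
    have rhs : (pullback.fst (A.baseChange f).X.hom t ≫ A.baseChangeToProd A f g hg) ≫ pullback.snd A.X.hom A.X.hom =
        pullback.snd (A.baseChange f).X.hom t ≫ t ≫ g :=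
      (Category.assoc _ _ _).trans
        ((congrArg (fun x => pullback.fst (A.baseChange f).X.hom t ≫ x) (A.baseChangeToProd_snd A f g hg)).trans
          ((Category.assoc _ _ _).symm.trans ((congrArg (fun x => x ≫ g) hc).trans (Category.assoc _ _ _))))
    exact lhs.trans rhs.symm

/-! ## §2 Field level: `(1_A × g₀)^*Λ(L)` lies in `Pic⁰(A_s)` — the theorem of the square on the fibre -/

/-- **`φ_c(P)` is translation invariant on an abelian variety** (field case): `t_Q^*(t_P^*c · c⁻¹) = t_P^*c · c⁻¹` in
`Ȟ¹(A, 𝒪^×)` for all rational points `P, Q` — a rephrasing of the theorem of the square `t_{QP}^*c · c = t_Q^*c · t_P^*c`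
(★ `pullback_translation_mul_mul_self'`). [cite: MumfordAV1970, §6 Cor. 4 (p. 59) and §8 (pp. 74–75)] -/
theorem cechPic_pullback_translation_phi {K : Type u} [Field K] (B : AbelianVariety K) (c : CechPic B.X.left)
    (P Q : B.Points K) :
    CechPic.pullback (B.translation Q).left (CechPic.pullback (B.translation P).left c * c⁻¹) =
      CechPic.pullback (B.translation P).left c * c⁻¹ := by
  rw [map_mul, map_inv, ← CechPic.pullback_comp, ← Over.comp_left, AbelianVariety.translation_comp']
  have hsq := pullback_translation_mul_mul_self' B c Q P
  -- `a · c = b · d` with `a = t_{QP}^*c`, `b = t_Q^*c`, `d = t_P^*c`; want `a · b⁻¹ = d · c⁻¹`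
  rw [mul_inv_eq_iff_eq_mul, mul_right_comm, eq_mul_inv_iff_mul_eq, hsq, mul_comm]

/-- **FIELD LEVEL: `(1_A × g₀)^*Λ(L)` lies in `Pic⁰(A_s)`** — for a rank-one `L` on `A`, a field-valued point `s` of `S` and
a point `g₀ : Spec Ω → A` over `s`, the module `(1_A × g₀)^*Λ(L)` on the abelian variety `A_s` is translation invariant.
With `g₀ = u_P` for the `Ω`-point `P` of `A_s` under it (★ `exists_points_fibrePointToLeft_eq`), its class is
`φ_{c_s}(P) = t_P^*c_s · c_s⁻¹`, `c_s = ι_s^*[L]` (★ `pullback_whiskerLeft_mumfordClass_homMk`), which is translation invariant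
by the theorem of the square on `A_s` (`cechPic_pullback_translation_phi`); a rank-one module is homogeneous iff its class
is (★ `isHomogeneous_iff_forall_pullback_detClass_eq`). [cite: MumfordAV1970, §6 Cor. 4 (p. 59) and §8 (pp. 74–75)]
[cite: MumfordFogartyKirwan1994, Ch. 6 §2 Definition 6.2 (p. 120)] -/
theorem isHomogeneous_pullback_baseChangeToProd_mumfordBundle (hL : HasRank L 1) {Ω : Type u} [Field Ω]
    (s : Spec (.of Ω) ⟶ S) (g₀ : Spec (.of Ω) ⟶ A.X.left) (hg₀ : g₀ ≫ A.X.hom = s) :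
    IsHomogeneous (A.fibre s).toAbelianVariety
      ((Scheme.Modules.pullback (A.baseChangeToProd A s g₀ hg₀)).obj (A.mumfordBundle L)) := by
  -- `g₀` is the point of `A` under an `Ω`-point `P` of the fibre
  obtain ⟨P, hP⟩ := A.exists_points_fibrePointToLeft_eq s (Over.homMk g₀ hg₀ : Over.mk s ⟶ A.X)
  have hbc : A.baseChangeToProd A s g₀ hg₀ =
      (A.X ◁ (Over.homMk (A.fibrePointToLeft s P) (A.fibrePointToLeft_comp_hom s P) : Over.mk s ⟶ A.X)).left :=
    (A.baseChangeToProd_congr A s hP.symm hg₀ (A.fibrePointToLeft_comp_hom s P)).trans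
      (A.baseChangeToProd_eq_whiskerLeft_left A
        (Over.homMk (A.fibrePointToLeft s P) (A.fibrePointToLeft_comp_hom s P) : Over.mk s ⟶ A.X))
  rw [hbc]
  have hΛ : IsFiniteLocallyFree (A.mumfordBundle L) := HasRank.isFiniteLocallyFree' (A.hasRank_mumfordBundle hL)
  have h1 : HasRank ((Scheme.Modules.pullback
      (A.X ◁ (Over.homMk (A.fibrePointToLeft s P) (A.fibrePointToLeft_comp_hom s P) : Over.mk s ⟶ A.X)).left).obj
        (A.mumfordBundle L)) 1 :=
    hasRank_pullback _ (A.hasRank_mumfordBundle hL)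
  rw [isHomogeneous_iff_forall_pullback_detClass_eq (A.fibre s).toAbelianVariety h1 (hΛ.pullback _)]
  intro Q
  rw [detClass_pullback _ hΛ, A.detClass_mumfordBundle hL hΛ]
  have e := A.pullback_whiskerLeft_mumfordClass_homMk s (detClass (HasRank.isFiniteLocallyFree' hL)) P
  exact (congrArg (CechPic.pullback ((A.fibre s).toAbelianVariety.translation Q).left) e).trans
    ((cechPic_pullback_translation_phi _ _ P Q).trans e.symm)

/-! ## §3 The Mumford family `(1_A × g)^*Λ(L)` on `A_T`: a rigidified fibrewise-`Pic⁰` line bundle -/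

section Family

variable (hL : HasRank L 1) (hε : CechPic.pullback A.unitSection (detClass (HasRank.isFiniteLocallyFree' hL)) = 1)

include hL in
/-- `(1_A × g)^*Λ(L)` is a line bundle. [cite: MumfordFogartyKirwan1994, Ch. 6 §2 Definition 6.2 (p. 120)] -/
theorem hasRank_mumfordFamily {T : Scheme.{u}} (f : T ⟶ S) (g : T ⟶ A.X.left) (hg : g ≫ A.X.hom = f) :
    HasRank ((Scheme.Modules.pullback (A.baseChangeToProd A f g hg)).obj (A.mumfordBundle L)) 1 :=
  hasRank_pullback _ (A.hasRank_mumfordBundle hL)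

include hε in
/-- **`(1_A × g)^*Λ(L)` is rigidified along `ε_T`** (`Λ(L)` is normalised along `ε × 1` because `L` is rigidified, ★
`nonempty_pullback_unitSection_baseChangeToProd_mumfordBundle_iso`, B-p08). [cite: MumfordFogartyKirwan1994, Ch. 6 §2 Definition 6.2 (p. 120)] -/
theorem rigid_mumfordFamily {T : Scheme.{u}} (f : T ⟶ S) (g : T ⟶ A.X.left) (hg : g ≫ A.X.hom = f) :
    Nonempty ((Scheme.Modules.pullback (A.baseChange f).unitSection).obj
      ((Scheme.Modules.pullback (A.baseChangeToProd A f g hg)).obj (A.mumfordBundle L)) ≅ SheafOfModules.unit _) :=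
  A.nonempty_pullback_unitSection_baseChangeToProd_mumfordBundle_iso hL hε (Over.homMk g hg : Over.mk f ⟶ A.X)

include hε in
/-- **The Mumford family `(1_A × g)^*Λ(L)` lies FIBREWISE IN `Pic⁰`** for every `f : T → S` and every `g : T → A` over `f`:
its geometric fibre at `t` is `(1_A × g(t))^*Λ(L)` on `A_{κ̄(t)}` (§1), which is translation invariant (§2).  So
`⟨(1_A × g)^*Λ(L), _, _⟩` is a test object of the universal property of any dual pair of `A`.
[cite: MumfordAV1970, §8 (pp. 74–75)] [cite: MilneAV2008, I §8 pp. 36–37] -/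
theorem fibrewisePicZero_mumfordFamily {T : Scheme.{u}} (f : T ⟶ S) (g : T ⟶ A.X.left) (hg : g ≫ A.X.hom = f) :
    (⟨(Scheme.Modules.pullback (A.baseChangeToProd A f g hg)).obj (A.mumfordBundle L), A.hasRank_mumfordFamily hL f g hg,
      A.rigid_mumfordFamily hL hε f g hg⟩ : A.RigidifiedLineBundle f).FibrewisePicZero := by
  intro Ω _ _ t
  have key := A.isHomogeneous_pullback_baseChangeToProd_mumfordBundle hL (t ≫ f) (t ≫ g) (by rw [Category.assoc, hg])
  have k1 := (isHomogeneous_pullback_iff_of_iso (A.fibreBaseChangeIso f t) _).2 key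
  refine (isHomogeneous_iff_of_iso _ ?_).1 k1
  exact (Scheme.Modules.pullbackComp _ _).app _ ≪≫
    (Scheme.Modules.pullbackCongr (A.fibreBaseChangeIso_comp_baseChangeToProd f g hg t)).app _ ≪≫
      ((Scheme.Modules.pullbackComp _ _).app _).symm

end Family

/-- `(1_A × u)^*𝒬 ≅ Λ(L)|_u` for the universal Mumford family `𝒬 = (1_A × 1_A)^*Λ(L)` on `A_A`: restriction of the
universal family along `u : T → A` (`(1_A × u) ≫ (1_A × 1_A) = 1_A × u = A ◁ u`, ★ `baseChangeToProd_eq_whiskerLeft_left`).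
[cite: MumfordFogartyKirwan1994, Ch. 6 §2 Definition 6.2 (p. 120)] -/
theorem nonempty_pullback_baseChangeToProd_universalMumford_iso {T : Over S} (u : T ⟶ A.X) :
    Nonempty ((Scheme.Modules.pullback (A.baseChangeToProd A T.hom u.left (Over.w u))).obj
        ((Scheme.Modules.pullback (A.baseChangeToProd A A.X.hom (𝟙 _) (Category.id_comp _))).obj (A.mumfordBundle L)) ≅
      (Scheme.Modules.pullback (A.X ◁ u).left).obj (A.mumfordBundle L)) := by
  have hc : A.baseChangeToProd A T.hom u.left (Over.w u) ≫ A.baseChangeToProd A A.X.hom (𝟙 _) (Category.id_comp _) =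
      (A.X ◁ u).left :=
    (congrArg (fun x => A.baseChangeToProd A T.hom u.left (Over.w u) ≫ x) A.baseChangeToProd_self_id).trans
      ((Category.comp_id _).trans (A.baseChangeToProd_eq_whiskerLeft_left A u))
  exact ⟨(Scheme.Modules.pullbackComp _ _).app _ ≪≫ (Scheme.Modules.pullbackCongr hc).app _⟩


/-! ## §4 `Λ(L) : A → Â` — the classifying morphism of the Mumford family is a HOMOMORPHISM -/

section Classify

variable [IsLocallyNoetherian S] [PreconnectedSpace S] (D : A.DualPair)
  (hD : Nonempty ((Scheme.Modules.pullback (DualPair.unitHatSlice D)).obj D.P ≅ SheafOfModules.unit _))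
  (hL : HasRank L 1) (hε : CechPic.pullback A.unitSection (detClass (HasRank.isFiniteLocallyFree' hL)) = 1)

include hD hε in
/-- **`Λ(L) : A → Â` IS A HOMOMORPHISM classifying the Mumford family, with kernel `K(L)`** ([MumfordFogartyKirwan1994] Ch. 6 §2
Def. 6.2 «`Λ(L)`», p. 120 «`Λ(L)` is a homomorphism»; [MumfordAV1970] §8 Thm. 1 / §13) over a CONNECTED locally Noetherian
base, for a dual pair `D = (Â, 𝒫)` with `𝒫|_{A × {ε_Â}} ≅ 𝒪` and a rigidified rank-one `L`: there is an `S`-morphism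
`λ_L : A → Â` such that (i) `λ_L` is a homomorphism of abelian schemes; (ii) `(1_A × (u ≫ λ_L))^*𝒫 ≅ Λ(L)|_u` for every
`S`-scheme `T` and every `u : T → A` (it CLASSIFIES the Mumford family: ★ `DualPair.universal` applied to the rigidified
fibrewise-`Pic⁰` family of §3, naturality ★ `classify_comap`); (iii) `u ∈ K(L)(T) ↔ u ≫ λ_L = 1` (★ `MemKOfL`; uniqueness in the
universal property).  (i) is rigidity: `λ_L ∘ ε_A` classifies `Λ(L)|_ε ≅ 𝒪` (★ `kOfL`, `one_mem`), as does `ε_Â` (by `hD`), so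
`ε ≫ λ_L = ε` and [MumfordFogartyKirwan1994] Cor. 6.4 in its connected-Noetherian form ★ `isMonHom_of_one_comp_of_isLocallyNoetherian`
applies — no reducedness of `S`. [cite: MumfordFogartyKirwan1994, Ch. 6 §2 Definition 6.2 (p. 120) and §1 Corollary 6.4 (p. 117)]
[cite: MumfordAV1970, §8 (pp. 74–75) and §13 (pp. 123–125)] [cite: MilneAV2008, I §8 pp. 36–37] -/
theorem exists_isMonHom_classify_mumfordBundle :
    ∃ lam : A.X ⟶ D.hat.X, IsMonHom lam ∧
      (∀ {T : Over S} (u : T ⟶ A.X),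
        Nonempty (D.pullbackP T.hom (u ≫ lam).left (Over.w _) ≅
          (Scheme.Modules.pullback (A.X ◁ u).left).obj (A.mumfordBundle L))) ∧
      ∀ {T : Over S} (u : T ⟶ A.X), A.MemKOfL L u ↔ u ≫ lam = 1 := by
  -- the universal Mumford family `𝒬 = (1_A × 1_A)^*Λ(L)` on `A_A` (base `A`), rigidified and fibrewise in `Pic⁰` (§3)
  let 𝒬 : A.RigidifiedLineBundle A.X.hom :=
    ⟨(Scheme.Modules.pullback (A.baseChangeToProd A A.X.hom (𝟙 _) (Category.id_comp _))).obj (A.mumfordBundle L),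
      A.hasRank_mumfordFamily hL _ _ _, A.rigid_mumfordFamily hL hε _ _ _⟩
  have h₀ : 𝒬.FibrewisePicZero := A.fibrewisePicZero_mumfordFamily hL hε _ _ _
  -- its classifying morphism
  let lam' : A.X.left ⟶ D.hat.X.left := D.classify A.X.hom 𝒬 h₀
  have hlam' : lam' ≫ D.hat.X.hom = A.X.hom := D.classify_comp_hom _ _ _
  let lam : A.X ⟶ D.hat.X := Over.homMk lam' hlam'
  -- (ii) the restriction formula
  have hres : ∀ {T : Over S} (u : T ⟶ A.X),
      Nonempty (D.pullbackP T.hom (u ≫ lam).left (Over.w _) ≅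
        (Scheme.Modules.pullback (A.X ◁ u).left).obj (A.mumfordBundle L)) := by
    intro T u
    obtain ⟨i⟩ := D.nonempty_pullbackP_classify_iso A.X.hom 𝒬 h₀
    obtain ⟨j⟩ := A.nonempty_pullback_baseChangeToProd_universalMumford_iso (L := L) u
    have hc : A.baseChangeToProd D.hat T.hom (u ≫ lam).left (Over.w _) =
        A.baseChangeToProd A T.hom u.left (Over.w u) ≫ A.baseChangeToProd D.hat A.X.hom lam' hlam' :=
      DualPair.baseChangeToProd_comp (A := A) T.hom u.left lam' (Over.w u) hlam'
    exact ⟨(Scheme.Modules.pullbackCongr hc).app D.P ≪≫ ((Scheme.Modules.pullbackComp _ _).app D.P).symm ≪≫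
      (Scheme.Modules.pullback (A.baseChangeToProd A T.hom u.left (Over.w u))).mapIso i ≪≫ j⟩
  -- the family `Λ(L)|_u` on `A_T` as a rigidified fibrewise-`Pic⁰` line bundle, and the two morphisms classifying it when
  -- it is trivial
  have hfam : ∀ {T : Over S} (u : T ⟶ A.X), ∃ ℒ : A.RigidifiedLineBundle T.hom,
      ℒ.L = (Scheme.Modules.pullback (A.X ◁ u).left).obj (A.mumfordBundle L) ∧ ℒ.FibrewisePicZero := by
    intro T u
    refine ⟨⟨(Scheme.Modules.pullback (A.baseChangeToProd A T.hom u.left (Over.w u))).obj (A.mumfordBundle L),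
      A.hasRank_mumfordFamily hL _ _ _, A.rigid_mumfordFamily hL hε _ _ _⟩, ?_, A.fibrewisePicZero_mumfordFamily hL hε _ _ _⟩
    exact congrArg (fun x => (Scheme.Modules.pullback x).obj (A.mumfordBundle L)) (A.baseChangeToProd_eq_whiskerLeft_left A u)
  have hunit : ∀ (T : Over S), Nonempty (D.pullbackP T.hom (T.hom ≫ D.hat.unitSection)
      (by rw [Category.assoc, D.hat.unitSection_comp_hom, Category.comp_id]) ≅ SheafOfModules.unit _) := fun T =>
    D.nonempty_pullbackP_comp_unitSection_iso T.hom hD _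
  -- (iii)′ for ANY `u`: `Λ(L)|_u ≅ 𝒪 ↔ u ≫ λ = 1`
  have hker : ∀ {T : Over S} (u : T ⟶ A.X), A.MemKOfL L u ↔ u ≫ lam = 1 := by
    intro T u
    have h1 : (1 : T ⟶ D.hat.X).left = T.hom ≫ D.hat.unitSection := by
      rw [Hom.one_def, Over.comp_left, Over.toUnit_left]
    constructor
    · rintro ⟨e⟩
      obtain ⟨ℒ, hℒL, hℒ⟩ := hfam u
      obtain ⟨i⟩ := hres u
      obtain ⟨k⟩ := hunit T
      have key := D.eq_of_nonempty_iso T.hom ℒ hℒ (u ≫ lam).left (T.hom ≫ D.hat.unitSection) (Over.w _)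
        (by rw [Category.assoc, D.hat.unitSection_comp_hom, Category.comp_id])
        ⟨i ≪≫ eqToIso hℒL.symm⟩ ⟨k ≪≫ e.symm ≪≫ eqToIso hℒL.symm⟩
      ext
      rw [key, h1]
    · intro h
      obtain ⟨i⟩ := hres u
      obtain ⟨k⟩ := hunit T
      have h' : (u ≫ lam).left = T.hom ≫ D.hat.unitSection := by rw [h, h1]
      exact ⟨i.symm ≪≫ eqToIso (D.pullbackP_congr T.hom h' (Over.w _) _) ≪≫ k⟩
  -- (i) `λ` kills the unit: `ε_A ∈ K(L)(S)` (★ `kOfL`, `one_mem`), so `η ≫ λ = 1 = η`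
  have hone : η[A.X] ≫ lam = η[D.hat.X] := by
    have h1 : (η[A.X] : 𝟙_ (Over S) ⟶ A.X) = 1 := by
      rw [Hom.one_def, toUnit_unique (toUnit _) (𝟙 _), Category.id_comp]
    have hmem : A.MemKOfL L (η[A.X] : 𝟙_ (Over S) ⟶ A.X) := by
      rw [h1]; exact (A.mem_kOfL_iff hL hε _).1 (A.kOfL L hL hε (𝟙_ (Over S))).one_mem
    rw [(hker _).1 hmem, Hom.one_def, toUnit_unique (toUnit _) (𝟙 _), Category.id_comp]
  haveI : IsMonHom lam := isMonHom_of_one_comp_of_isLocallyNoetherian (A := A) (B := D.hat) lam hone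
  exact ⟨lam, inferInstance, hres, hker⟩

/-! ## §5 THE THEOREM OF THE SQUARE over any `S`-scheme `T` -/

include hD hε in
/-- **THE THEOREM OF THE SQUARE for an abelian scheme over a CONNECTED locally Noetherian base (no reducedness), given a
dual pair**: for every `S`-scheme `T` and all `u, v : T → A`,
`Λ(L)|_{u·v} ≅ Λ(L)|_u ⊗ Λ(L)|_v` on `A ×_S T`, i.e. `[t_{u+v}^*L_T ⊗ L_T⁻¹] = [t_u^*L_T ⊗ L_T⁻¹]·[t_v^*L_T ⊗ L_T⁻¹]` —
[MumfordAV1970] §6 Cor. 4 / [MumfordFogartyKirwan1994] p. 120 «for all `L`, `Λ(L)` is a homomorphism from `X` to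
`Pic(X/S)`» over a base `S` that may be NON-reduced.  Proof: `Λ(L)|_w ≅ (1_A × (w ≫ λ_L))^*𝒫` (§4 (ii)), `λ_L` is a
homomorphism (§4 (i)), and the group law of `Â` is the tensor product of families over a connected locally Noetherian base
(★ `DualPair.nonempty_pullbackP_mul_iso_of_isLocallyNoetherian`). [cite: MumfordAV1970, §6 Cor. 4 (p. 59) and §8 (pp. 74–75)]
[cite: MumfordFogartyKirwan1994, Ch. 6 §2 Definition 6.2 (p. 120)] -/
theorem nonempty_pullback_whiskerLeft_mul_mumfordBundle_iso {T : Over S} (u v : T ⟶ A.X) :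
    Nonempty ((Scheme.Modules.pullback (A.X ◁ (u * v)).left).obj (A.mumfordBundle L) ≅
      tensorObj ((Scheme.Modules.pullback (A.X ◁ u).left).obj (A.mumfordBundle L))
        ((Scheme.Modules.pullback (A.X ◁ v).left).obj (A.mumfordBundle L))) := by
  obtain ⟨lam, hlam, hres, -⟩ := A.exists_isMonHom_classify_mumfordBundle D hD hL hε
  obtain ⟨iuv⟩ := hres (u * v)
  obtain ⟨iu⟩ := hres u
  obtain ⟨iv⟩ := hres v
  obtain ⟨m⟩ := D.nonempty_pullbackP_mul_iso_of_isLocallyNoetherian hD (u ≫ lam) (v ≫ lam)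
  have hmul : ((u * v) ≫ lam).left = ((u ≫ lam) * (v ≫ lam)).left := congrArg CommaMorphism.left (MonObj.mul_comp u v lam)
  exact ⟨iuv.symm ≪≫ eqToIso (D.pullbackP_congr T.hom hmul (Over.w _) (Over.w _)) ≪≫ m ≪≫ tensorMapIso iu iv⟩

include hD in
/-- **The theorem of the square, class form**: for a class `c ∈ Ȟ¹(A, 𝒪^×)` normalised along the zero section and all
`u, v : T → A` over `S`, `(1 × (u·v))^*[Λ]c = (1 × u)^*[Λ]c · (1 × v)^*[Λ]c` in `Ȟ¹(A ×_S T, 𝒪^×)` (★ `mumfordClass`; every class is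
the class of a line bundle, ★ `lineBundle`). [cite: MumfordAV1970, §6 Cor. 4 (p. 59)] [cite: MumfordFogartyKirwan1994, Ch. 6 §2 Definition 6.2 (p. 120)] -/
theorem cechPic_pullback_whiskerLeft_mul_mumfordClass (c : CechPic A.left) (hc : CechPic.pullback A.unitSection c = 1)
    {T : Over S} (u v : T ⟶ A.X) :
    CechPic.pullback (A.X ◁ (u * v)).left (A.mumfordClass c) =
      CechPic.pullback (A.X ◁ u).left (A.mumfordClass c) * CechPic.pullback (A.X ◁ v).left (A.mumfordClass c) := by
  obtain ⟨c, rfl⟩ := CechPic.mk_surjective c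
  have hL : HasRank (lineBundle c) 1 := c.hasRank_lineBundle
  have hcl : detClass (HasRank.isFiniteLocallyFree' hL) = CechPic.mk c := c.detClass_lineBundle
  rw [← hcl] at hc ⊢
  obtain ⟨i⟩ := A.nonempty_pullback_whiskerLeft_mul_mumfordBundle_iso D hD hL hc u v
  have hΛ : IsFiniteLocallyFree (A.mumfordBundle (lineBundle c)) :=
    HasRank.isFiniteLocallyFree' (A.hasRank_mumfordBundle hL)
  have h1 : ∀ w : T ⟶ A.X, HasRank ((Scheme.Modules.pullback (A.X ◁ w).left).obj (A.mumfordBundle (lineBundle c))) 1 :=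
    fun w => hasRank_pullback _ (A.hasRank_mumfordBundle hL)
  have key := detClass_eq_of_iso i (hΛ.pullback _) (HasRank.isFiniteLocallyFree' (hasRank_tensorObj_one (h1 u) (h1 v)))
  rw [detClass_tensorObj_of_hasRank_one (h1 u) (h1 v) (hΛ.pullback _) (hΛ.pullback _) _, detClass_pullback _ hΛ,
    detClass_pullback _ hΛ, detClass_pullback _ hΛ, A.detClass_mumfordBundle hL hΛ] at key
  exact key

end Classify

end AbelianSchemeOver

end Literature.AlgebraicGeometry.AbelianSchemes

end
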